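import Literature.NumberTheory.Automorphic.BorelOrbitsFinite
import Literature.NumberTheory.Automorphic.BorelStabilizerCohomology
import Literature.NumberTheory.Automorphic.NeatLevelImaginaryQuadratic
import Literature.NumberTheory.Automorphic.TwistedCohomologyFiniteOrbits
import Literature.NumberTheory.Automorphic.TwistedQuotientLevelPullback
import Literature.NumberTheory.Automorphic.TwistedQuotientSubgroupModel
import Literature.NumberTheory.Automorphic.OpenCompactLevelGL
import HarnessLib

/-!
# The cohomology of the Borel stratum of a Bianchi group is finite dimensional

Topic `NumberTheory/Automorphic`; namespace `Literature.NumberTheory.Automorphic`, grouping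
sub-namespace `ParallelWeight`.  Theorems only.

Let `F` be imaginary quadratic, `B = borel F ≤ GL₂(F)` the upper triangular Borel subgroup acting
on `GL₂(𝔸_F^∞)` through the diagonal embedding `ι`, and `V` a representation of `B(F)` finitely
generated over a Noetherian ring `k`.

* `moduleFinite_cohomology_borel_principalLevel` — at a non-zero NEAT principal level `K_f(𝔫)`,
  `H^q(B(F), Fun(GL₂(𝔸_F^∞) ⧸ K_f(𝔫), V))` is finitely generated: finitely many orbits
  (`BorelOrbitsFinite.exists_finite_cover_borelOrbits`) whose stabilisers have finitely generated
  cohomology (`BorelStabilizerCohomology`), and Shapiro (`TwistedCohomologyFiniteOrbits`);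
* `moduleFinite_cohomology_borel` — for EVERY open compact level `U` and `k` a field of
  characteristic zero: pull back injectively (`TwistedQuotientLevelPullback.pullbackMap_injective`,
  the index `[U : K_f(𝔫)]` is finite and invertible) to a neat `K_f(𝔫) ≤ U`
  (`NeatLevelImaginaryQuadratic.exists_neat_level`, `OpenCompactLevelGL`);
* `moduleFinite_cohomology_borel_subgroupModel` — the same for the models
  `H^q(B(F), Fun(H ⧸ (U ∩ H), V))` on subgroups `H ∋ ι(B(F))` with `H · U = GL₂(𝔸_F^∞)`
  (`TwistedQuotientSubgroupModel.isIso_subgroupRestrictMap`), e.g. `H = H_S`.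

This is the finiteness input ("the boundary of the Borel–Serre compactification of a Bianchi
orbifold has finitely many components, each a torus bundle") for the Hecke analysis of the
boundary cohomology. [cite: Harder1987, §2]

## References

* G. Harder, *Eisenstein cohomology of arithmetic groups. The case GL₂*, Invent. Math. 89 (1987), §2
  [Harder1987].
-/

noncomputable section

open scoped NumberField
open IsDedekindDomain CategoryTheory NumberField

namespace Literature.NumberTheory.Automorphic

namespace ParallelWeight

open BigHeckeGLn

variable {F : Type} [Field F] [NumberField F]

/-- **Finiteness at a neat principal level.** [cite: Harder1987, §2] -/
theorem moduleFinite_cohomology_borel_principalLevel (hF : Module.finrank ℚ F = 2)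
    {𝔫 : Ideal (𝓞 F)} (h𝔫 : 𝔫 ≠ 0)
    (hneat : ∀ a : F, (∀ v : HeightOneSpectrum (𝓞 F), v.valuation F a ≤ 1) →
      (∀ v : HeightOneSpectrum (𝓞 F), v.valuation F a⁻¹ ≤ 1) →
      (∀ v : HeightOneSpectrum (𝓞 F), v.valuation F (a - 1) ≤ idealRadius F v 𝔫) → a = 1)
    {k : Type} [CommRing k] [IsNoetherianRing k] {V : Type} [AddCommGroup V] [Module k V]
    [Module.Finite k V] (ρ : Representation k (borel F) V) (q : ℕ) :
    Module.Finite k (TwistedQuotient.cohomology ((globalEmbedding 2 F).comp (borel F).subtype)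
      ((principalCongruenceLevel 2 F 𝔫).comap (GLn.ofFinite 2 F)) ρ q) := by
  obtain ⟨s₀, hs₀, hcov⟩ := exists_finite_cover_borelOrbits (F := F) h𝔫
  refine TwistedQuotient.moduleFinite_cohomology_of_finite_cover _ _ ρ s₀ hcov q fun x hx => ?_
  obtain ⟨t, c, hc, rfl⟩ := hs₀ x hx
  exact moduleFinite_groupCohomology_borelStabilizer hF h𝔫 hneat t hc ρ q

/-- **Finiteness at every open compact level** (imaginary quadratic `F`, `k` a field of
characteristic zero). [cite: Harder1987, §2] -/
theorem moduleFinite_cohomology_borel [IsTotallyComplex F] (hF : Module.finrank ℚ F = 2)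
    (U : Subgroup (FiniteAdelicGL 2 F)) (hUo : IsOpen (U : Set (FiniteAdelicGL 2 F)))
    (hUc : IsCompact (U : Set (FiniteAdelicGL 2 F)))
    {k : Type} [Field k] [CharZero k] {V : Type} [AddCommGroup V] [Module k V]
    [Module.Finite k V] (ρ : Representation k (borel F) V) (q : ℕ) :
    Module.Finite k (TwistedQuotient.cohomology ((globalEmbedding 2 F).comp (borel F).subtype) U ρ q) := by
  -- a neat principal level inside `U`
  obtain ⟨𝔫₀, h𝔫₀, hU0⟩ := exists_principalCongruenceLevel_sndHom_mem (n := 2) (K := F) hUo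
  obtain ⟨𝔫, h𝔫, hle𝔫, hneat⟩ := exists_neat_level hF h𝔫₀
  have hle : (principalCongruenceLevel 2 F 𝔫).comap (GLn.ofFinite 2 F) ≤ U :=
    (comap_principalCongruenceLevel_mono h𝔫 hle𝔫).trans
      (comap_principalCongruenceLevel_le_of_sndHom_mem hU0)
  haveI hfi : (((principalCongruenceLevel 2 F 𝔫).comap (GLn.ofFinite 2 F)).subgroupOf U).FiniteIndex :=
    Subgroup.finiteIndex_subgroupOf_of_isCompact_isOpen hUc
      (isOpen_comap_ofFinite_principalCongruenceLevel 2 F h𝔫)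
  haveI := moduleFinite_cohomology_borel_principalLevel hF h𝔫 hneat ρ q
  haveI : IsNoetherian k (TwistedQuotient.cohomology ((globalEmbedding 2 F).comp (borel F).subtype)
      ((principalCongruenceLevel 2 F 𝔫).comap (GLn.ofFinite 2 F)) ρ q) :=
    isNoetherian_of_isNoetherianRing_of_finite k _
  refine Module.Finite.of_injective
    (TwistedQuotient.pullbackMap ((globalEmbedding 2 F).comp (borel F).subtype) ρ hle q).hom
    (TwistedQuotient.pullbackMap_injective _ ρ hle q fun x hx => ?_)
  have hidx : ((((principalCongruenceLevel 2 F 𝔫).comap (GLn.ofFinite 2 F)).subgroupOf U).index : k) ≠ 0 :=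
    Nat.cast_ne_zero.2 Subgroup.FiniteIndex.index_ne_zero
  rw [← Nat.cast_smul_eq_nsmul k, smul_eq_zero] at hx
  exact hx.resolve_left hidx

/-- **Finiteness for the subgroup models** `H^q(B(F), Fun(H ⧸ (U ∩ H), V))`, `H · U = GL₂(𝔸_F^∞)`.
[cite: Harder1987, §2] -/
theorem moduleFinite_cohomology_borel_subgroupModel [IsTotallyComplex F]
    (hF : Module.finrank ℚ F = 2) (U : Subgroup (FiniteAdelicGL 2 F))
    (hUo : IsOpen (U : Set (FiniteAdelicGL 2 F))) (hUc : IsCompact (U : Set (FiniteAdelicGL 2 F)))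
    (H : Subgroup (FiniteAdelicGL 2 F))
    (hι : ∀ γ : borel F, ((globalEmbedding 2 F).comp (borel F).subtype) γ ∈ H)
    (hHU : ∀ g : FiniteAdelicGL 2 F, ∃ h : H, ∃ u ∈ U, g = (h : FiniteAdelicGL 2 F) * u)
    {k : Type} [Field k] [CharZero k] {V : Type} [AddCommGroup V] [Module k V]
    [Module.Finite k V] (ρ : Representation k (borel F) V) (q : ℕ) :
    Module.Finite k (TwistedQuotient.cohomology
      (((globalEmbedding 2 F).comp (borel F).subtype).codRestrict H hι) (U.subgroupOf H) ρ q) := by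
  haveI := moduleFinite_cohomology_borel hF U hUo hUc ρ q
  haveI := TwistedQuotient.isIso_subgroupRestrictMap ((globalEmbedding 2 F).comp (borel F).subtype)
    U ρ H hι hHU q
  exact Module.Finite.equiv
    (asIso (TwistedQuotient.subgroupRestrictMap ((globalEmbedding 2 F).comp (borel F).subtype)
      U ρ H hι q)).toLinearEquiv

end ParallelWeight

end Literature.NumberTheory.Automorphic
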